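import Literature.IUT.LogVolume.Corollary22TorsionCoordinates
import HarnessLib

/-!
# [IUTchIV] Cor. 2.2 (ii) / Thm. 1.10: the field `F = F_tpd(√−1, E_{F_tpd}[3·5])` EXISTS

Mochizuki, *Inter-universal Teichmüller theory IV*, RIMS manuscript (Apr. 2020; = PRIMS **57** (2021)),
Thm. 1.10, p. 22 ("we assume that the `(3·5)`-torsion points of `E_F` are defined over `F`, and that
`F = F_mod(√−1, E_{F_mod}[2·3·5]) = F_tpd(√−1, E_{F_tpd}[3·5])`") and proof of Cor. 2.2 (ii), p. 42
("`F := F_tpd(√−1, E_{F_tpd}[3·5])` … it follows from Proposition 1.8, (v), that `E_F` has stable reduction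
at every element of `𝕍(F)^non`"). In `Corollary22Legendre.lean` (abc-iut-S-d2) this field is a PREDICATE
`Cor22.IsThetaField P F` over which `Cor22.CondP6` and the interface `Cor22.Thm110Legendre` quantify; this
proof-only file shows that the predicate is INHABITED for every `λ ∈ U_X`:

* `Cor22.exists_isThetaField` — for `P = (F_tpd, λ)`, `λ ≠ 0, 1`, the number field
  `F := F_tpd(±i, coordinates of E[15](Q̄)) ⊆ Q̄` (`E : y² = x(x−1)(x−λ)`) satisfies `IsThetaField P F`:
  `√−1 ∈ F`; `E_F[15](F̄)` is `Gal(F̄/F)`-fixed (cross-closure transport of abc-iut-S-d4 at levels `3`, `5`, and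
  `T = 10T − 9T`); `F` is generated by `±√−1` and the torsion coordinates (a torsion point of `E(Q̄)` with
  coordinates in `F` descends to `E(F)`); `F/F_tpd` Galois (adjunction of a finite Galois-stable set);
  `[F : F_tpd] ∣ 46080 = |ℤ/2 × GL₂(𝔽₃) × GL₂(𝔽₅)|` (Krull index of `ker ρ̄₃ ∩ ker ρ̄₅ ∩ Gal(Q̄/F_tpd(i))`, with
  abc-iut-S5's `index_ker_galoisRepTorsion_dvd`); `E_F` semistable (Raynaud's criterion, tree).
Classical; TAKES NO SIDE on [IUTchIII] Cor. 3.12. Proof-only (no definitions, no named facts). Note: the group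
law on `E(F)` depends on a `DecidableEq F` instance; we fix the classical one used by `torsionCoords`.
-/

noncomputable section

open scoped Classical

namespace Literature.IUT.LogVolume

namespace Cor22

open NumberField IsDedekindDomain Literature.NumberTheory.DiophantineGeometry.GenEll
open Literature.NumberTheory.EllipticCurves WeierstrassCurve IntermediateField Field

section Construction

variable (P : NFPoint)

/-- The index of an intersection with a normal subgroup divides the product of the indices.
[folklore] -/
private theorem index_inf_dvd_mul {G : Type*} [Group G] (A B : Subgroup G) [A.Normal] :
    (A ⊓ B).index ∣ A.index * B.index := by
  rw [← Subgroup.relIndex_mul_index (inf_le_right : A ⊓ B ≤ B), Subgroup.inf_relIndex_right]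
  exact Nat.mul_dvd_mul_right (Subgroup.relIndex_dvd_index_of_normal A B) B.index

/-- `[K(i) : K] ∣ 2` for a square root `i` of `−1`. [folklore] -/
private theorem index_fixingSubgroup_adjoin_sqrt_dvd_two {K : Type} [Field K] [NumberField K]
    {i : AlgebraicClosure K}
    (hi : i ^ 2 = -1) :
    (adjoin K ({i} : Set (AlgebraicClosure K))).fixingSubgroup.index ∣ 2 := by
  rw [← IntermediateField.finrank_eq_fixingSubgroup_index]
  have hint : IsIntegral K i := Algebra.IsIntegral.isIntegral i
  rw [adjoin.finrank hint]
  have hroot : Polynomial.aeval i (Polynomial.X ^ 2 + Polynomial.C 1 : Polynomial K) = 0 := by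
    simp [hi]
  have hdvd : minpoly K i ∣ Polynomial.X ^ 2 + Polynomial.C 1 := minpoly.dvd K i hroot
  have hmon : (Polynomial.X ^ 2 + Polynomial.C 1 : Polynomial K).Monic :=
    Polynomial.monic_X_pow_add_C 1 two_ne_zero
  have hdeg := Polynomial.natDegree_le_of_dvd hdvd hmon.ne_zero
  rw [Polynomial.natDegree_X_pow_add_C] at hdeg
  have hpos : 0 < (minpoly K i).natDegree := minpoly.natDegree_pos hint
  interval_cases (minpoly K i).natDegree <;> norm_num

/-- **The field `F = F_tpd(√−1, E_{F_tpd}[3·5])` exists** ([IUTchIV] Thm. 1.10, p. 22; Cor. 2.2 (ii),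
p. 42: "`F := F_tpd(√−1, E_{F_tpd}[3·5])`"): for every `λ ∈ U_X(F_tpd)` the number field
`F := F_tpd(±i, coords(E[15](Q̄))) ⊆ Q̄` satisfies `IsThetaField P F` (`√−1 ∈ F`; `E_F[15]` rational over `F̄`;
generated by `±√−1` and the torsion coordinates; Galois over `F_tpd`; `[F : F_tpd] ∣ 46080`; `E_F` semistable
by [IUTchIV] Prop. 1.8 (v) = Raynaud's criterion in the tree). In particular `Cor22.CondP6` /
`Cor22.Thm110Legendre`, which quantify over theta-fields, are not vacuous. [claim: Mochizuki2012, status: disputed] -/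
theorem exists_isThetaField (hU : P.InU) :
    ∃ F : IntermediateField P.F (AlgebraicClosure P.F), ∃ _ : NumberField F, IsThetaField P F := by
  haveI hE : P.legendreCurve.IsElliptic := P.legendreCurve_isElliptic_iff.2 hU
  haveI hfact3 : Fact (Nat.Prime 3) := ⟨Nat.prime_three⟩
  haveI hfact5 : Fact (Nat.Prime 5) := ⟨Nat.prime_five⟩
  set Ω := AlgebraicClosure P.F with hΩdef
  set W₀ : WeierstrassCurve P.F := P.legendreCurve with hW₀def
  obtain ⟨i, hi⟩ : ∃ i : Ω, i ^ 2 = -1 := IsAlgClosed.exists_pow_nat_eq (-1 : Ω) two_pos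
  set Tor : Set (geomPoints W₀) := {T | (15 : ℤ) • T = 0} with hTordef
  have hTorfin : Tor.Finite := by
    haveI := finite_torsionPoints_holds W₀ Ω (n := (15 : ℤ)) (by norm_num)
    haveI : Finite Tor := Finite.of_injective
      (fun T : Tor => (⟨(T.1 : (W₀.baseChange Ω).toAffine.Point),
        (mem_torsionPoints_iff (W := W₀) (L := Ω) _).2 T.2⟩ : torsionPoints W₀ Ω (15 : ℤ)))
      (fun a b h => Subtype.ext (show (a.1 : geomPoints W₀) = b.1 from congrArg Subtype.val h))
    exact Set.toFinite Tor
  set S₁₅ : Set Ω := ⋃ T ∈ Tor, pointCoords T with hS₁₅def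
  set S : Set Ω := {i, -i} ∪ S₁₅ with hSdef
  have hSfin : S.Finite :=
    ((Set.finite_singleton (-i)).insert i).union (hTorfin.biUnion fun T _ => pointCoords_finite T)
  have hmemS₁₅ : ∀ {T : geomPoints W₀}, (15 : ℤ) • T = 0 → ∀ z ∈ pointCoords T, z ∈ S := by
    intro T hT z hz
    refine Or.inr (Set.mem_iUnion₂.2 ⟨T, hT, hz⟩)
  have hTor_smul : ∀ (τ : absoluteGaloisGroup P.F) {T : geomPoints W₀}, (15 : ℤ) • T = 0 →
      (15 : ℤ) • (τ • T) = 0 := by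
    intro τ T hT
    rw [smul_comm, hT, smul_zero]
  have hSstab : ∀ σ : Ω ≃ₐ[P.F] Ω, ∀ s ∈ S, σ s ∈ S := by
    intro σ s hs
    rcases hs with hs | hs
    · -- `s = ±i`
      have hsq : ∀ t : Ω, t ^ 2 = -1 → σ t ∈ ({i, -i} : Set Ω) := by
        intro t ht
        have h1 : (σ t) ^ 2 = i ^ 2 := by rw [← map_pow, ht, hi, map_neg, map_one]
        rcases sq_eq_sq_iff_eq_or_eq_neg.1 h1 with h | h
        · exact Or.inl h
        · exact Or.inr h
      rcases hs with rfl | rfl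
      · exact Or.inl (hsq _ hi)
      · exact Or.inl (hsq _ (by rw [neg_sq, hi]))
    · obtain ⟨T, hT, hz⟩ := Set.mem_iUnion₂.1 hs
      set τ : absoluteGaloisGroup P.F := (absoluteGaloisGroup.toAlgEquiv P.F).symm σ with hτ
      have hστ : σ s = τ • s := (absoluteGaloisGroup.toAlgEquiv_symm_apply σ s).symm
      rw [hστ]
      refine hmemS₁₅ (hTor_smul τ hT) _ ?_
      rw [pointCoords_smul]
      exact ⟨s, hz, rfl⟩
  set F : IntermediateField P.F Ω := adjoin P.F S with hFdef
  haveI : Finite S := hSfin.to_subtype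
  haveI hFD : FiniteDimensional P.F F :=
    finiteDimensional_adjoin fun x _ => Algebra.IsIntegral.isIntegral x
  haveI hNF : NumberField F := NumberField.of_module_finite P.F F
  refine ⟨F, hNF, ?_⟩
  have hfix : ∀ σ : absoluteGaloisGroup P.F, σ ∈ F.fixingSubgroup → ∀ T : geomPoints W₀,
      (15 : ℤ) • T = 0 → σ • T = T := by
    intro σ hσ T hT
    refine smul_eq_of_forall_coords P σ T fun z hz => ?_
    exact forall_eq_of_mem_fixingSubgroup_adjoin hσ z (hmemS₁₅ hT z hz)
  have hker : ∀ n : ℕ, (n : ℤ) ∣ 15 → F.fixingSubgroup ≤ (W₀.galoisRepTorsion (n : ℤ)).ker := by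
    intro n hn σ hσ
    obtain ⟨m, hm⟩ := hn
    set τ : absoluteGaloisGroup P.F := (absoluteGaloisGroup.toAlgEquiv P.F).symm σ with hτ
    have key := (Set.ext_iff.1 (coe_ker_galoisRepTorsion W₀ (n : ℤ)) τ).2
    refine key (Set.mem_iInter.2 fun Q => ?_)
    rw [SetLike.mem_coe, MulAction.mem_stabilizer_iff]
    refine hfix τ hσ Q ?_
    have hQ : (n : ℤ) • (Q : geomPoints W₀) = 0 :=
      (Submodule.mem_torsionBy_iff (n : ℤ) (Q : geomPoints W₀)).mp Q.2
    rw [hm, mul_comm, mul_smul, hQ, smul_zero]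
  have hker3 := hker 3 ⟨5, by norm_num⟩
  have hker5 := hker 5 ⟨3, by norm_num⟩
  have hW : thetaCurve P F = (P.legendre hU).W.map (algebraMap P.F F) := thetaCurve_eq_map P F
  have hrat3 := @EllPoint.forall_smul_geomTorsion_map_eq_of_fixingSubgroup_le (P.legendre hU) F hNF 3 hker3
  have hrat5 := @EllPoint.forall_smul_geomTorsion_map_eq_of_fixingSubgroup_le (P.legendre hU) F hNF 5 hker5
  refine
    { sqrt_neg_one := ?_
      torsion_rational := ?_
      adjoin_eq_top := ?_
      isGalois := isGalois_adjoin_of_stable hSstab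
      finrank_dvd := ?_
      isSemistable := ?_ }
  · -- `√-1 ∈ F`
    refine ⟨⟨i, subset_adjoin P.F S (Or.inl (Or.inl rfl))⟩, ?_⟩
    apply Subtype.ext
    simp [hi]
  · -- the `15`-torsion of `E_F` over `F̄` is `Gal(F̄/F)`-fixed
    rw [hW]
    intro σ T hT
    exact smul_eq_of_fifteen σ (hrat3 σ) (hrat5 σ) T hT
  · -- `F` is generated by `±√-1` and the torsion coordinates
    letI instF : DecidableEq F := fun a b => Classical.propDecidable (a = b)
    rw [torsionCoords_eq P F, eq_top_iff]
    rintro ⟨ω, hω⟩ -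
    induction hω using adjoin_induction with
    | mem x hx =>
      apply subset_adjoin
      rcases hx with hx | hx
      · -- `x = ± i`
        left
        show (⟨x, _⟩ : F) ^ 2 = -1
        apply Subtype.ext
        show x ^ 2 = ((-1 : F) : Ω)
        rcases hx with rfl | rfl
        · rw [hi]; simp
        · rw [neg_sq, hi]; simp
      · -- `x` is a coordinate of a `15`-torsion point `T`
        right
        obtain ⟨T, hT, hz⟩ := Set.mem_iUnion₂.1 hx
        rcases T with _ | ⟨a, b, hab⟩
        · simp [pointCoords] at hz
        · have haS : a ∈ S := hmemS₁₅ hT a (by simp [pointCoords])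
          have hbS : b ∈ S := hmemS₁₅ hT b (by simp [pointCoords])
          have hT' : (15 : ℤ) • Affine.Point.some a b hab = 0 := hT
          obtain ⟨TF, h15, haT, hbT⟩ := exists_torsionPoint_baseChange W₀ F
            (subset_adjoin P.F S haS) (subset_adjoin P.F S hbS) hab hT'
          refine Set.mem_iUnion₂.2 ⟨TF, h15, ?_⟩
          simp only [pointCoords, Set.mem_insert_iff, Set.mem_singleton_iff] at hz
          rcases hz with hxa | hxb
          · have hxe : (⟨x, subset_adjoin P.F S (Or.inr hx)⟩ : F) = ⟨a, subset_adjoin P.F S haS⟩ :=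
              Subtype.ext hxa
            rw [hxe]; exact haT
          · have hxe : (⟨x, subset_adjoin P.F S (Or.inr hx)⟩ : F) = ⟨b, subset_adjoin P.F S hbS⟩ :=
              Subtype.ext hxb
            rw [hxe]; exact hbT
    | algebraMap k =>
      have : (⟨algebraMap P.F Ω k, IntermediateField.algebraMap_mem _ k⟩ : F) = algebraMap P.F F k :=
        Subtype.ext rfl
      rw [this]
      exact IntermediateField.algebraMap_mem _ k
    | add x y hx hy ihx ihy =>
      have : (⟨x + y, add_mem hx hy⟩ : F) = ⟨x, hx⟩ + ⟨y, hy⟩ := rfl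
      rw [this]
      exact add_mem ihx ihy
    | inv x hx ihx =>
      have : (⟨x⁻¹, inv_mem hx⟩ : F) = (⟨x, hx⟩ : F)⁻¹ := rfl
      rw [this]
      exact inv_mem ihx
    | mul x y hx hy ihx ihy =>
      have : (⟨x * y, mul_mem hx hy⟩ : F) = ⟨x, hx⟩ * ⟨y, hy⟩ := rfl
      rw [this]
      exact mul_mem ihx ihy
  · -- `[F : F_tpd] ∣ 46080`
    set K3 : Subgroup (absoluteGaloisGroup P.F) := (W₀.galoisRepTorsion ((3 : ℕ) : ℤ)).ker with hK3
    set K5 : Subgroup (absoluteGaloisGroup P.F) := (W₀.galoisRepTorsion ((5 : ℕ) : ℤ)).ker with hK5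
    haveI : K3.Normal := MonoidHom.normal_ker _
    haveI : K5.Normal := MonoidHom.normal_ker _
    haveI hK35 : (K3 ⊓ K5).Normal := Subgroup.normal_inf_normal K3 K5
    set Hi : Subgroup (absoluteGaloisGroup P.F) := (adjoin P.F ({i} : Set Ω)).fixingSubgroup with hHidef
    set H : Subgroup (absoluteGaloisGroup P.F) := (K3 ⊓ K5) ⊓ Hi with hHdef
    have hHfix : ∀ σ ∈ H, ∀ s ∈ S, σ • s = s := by
      intro τ hσ s hs
      have hσ3 : τ ∈ K3 := hσ.1.1
      have hσ5 : τ ∈ K5 := hσ.1.2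
      have hσi : absoluteGaloisGroup.toAlgEquiv P.F τ i = i :=
        forall_eq_of_mem_fixingSubgroup_adjoin (σ := absoluteGaloisGroup.toAlgEquiv P.F τ) hσ.2 i rfl
      rcases hs with hs | hs
      · rcases hs with rfl | rfl
        · exact hσi
        · show absoluteGaloisGroup.toAlgEquiv P.F τ (-i) = -i
          rw [map_neg, hσi]
      · obtain ⟨T, hT, hz⟩ := Set.mem_iUnion₂.1 hs
        have h3 : ∀ Q : geomTorsion W₀ ((3 : ℕ) : ℤ), τ • Q = Q := by
          intro Q
          have hQ := galoisRepTorsion_apply W₀ ((3 : ℕ) : ℤ) τ Q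
          rw [(MonoidHom.mem_ker).1 hσ3] at hQ
          exact hQ.symm
        have h5 : ∀ Q : geomTorsion W₀ ((5 : ℕ) : ℤ), τ • Q = Q := by
          intro Q
          have hQ := galoisRepTorsion_apply W₀ ((5 : ℕ) : ℤ) τ Q
          rw [(MonoidHom.mem_ker).1 hσ5] at hQ
          exact hQ.symm
        have hfixT := smul_eq_of_fifteen τ h3 h5 T hT
        exact forall_coords_of_smul_eq P τ T hfixT s hz
    have hdvd : Module.finrank P.F F ∣ H.index := finrank_adjoin_dvd_index H hHfix
    refine hdvd.trans ?_
    have h1 : H.index ∣ (K3 ⊓ K5).index * Hi.index := index_inf_dvd_mul _ _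
    have h2 : (K3 ⊓ K5).index ∣ (3 * (3 - 1) ^ 2 * (3 + 1)) * (5 * (5 - 1) ^ 2 * (5 + 1)) :=
      (index_inf_dvd_mul _ _).trans
        (Nat.mul_dvd_mul (W₀.index_ker_galoisRepTorsion_dvd 3) (W₀.index_ker_galoisRepTorsion_dvd 5))
    have h3 : Hi.index ∣ 2 := index_fixingSubgroup_adjoin_sqrt_dvd_two hi
    refine h1.trans ?_
    have : (3 * (3 - 1) ^ 2 * (3 + 1)) * (5 * (5 - 1) ^ 2 * (5 + 1)) * 2 = 46080 := by norm_num
    rw [← this]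
    exact Nat.mul_dvd_mul h2 h3
  · -- semistability of `E_F` (Raynaud's criterion with `p = 3`, `q = 5`)
    rw [hW]
    haveI : ((P.legendre hU).W.map (algebraMap P.F F)).IsElliptic := by
      rw [← hW]; exact thetaCurve_isElliptic hU F
    exact ((P.legendre hU).W.map (algebraMap P.F F)).isSemistable_of_forall_smul_geomTorsion_eq_of_ne
      Nat.prime_three Nat.prime_five le_rfl (by norm_num) (by norm_num) hrat3 hrat5

end Construction

end Cor22

end Literature.IUT.LogVolume

end
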